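import Summits.QuantumFields.BalabanUV.Beta.D1BFx.TwoPointBubbles

/-!
# `BalabanUV.Beta.D1BFx.TwoPointBubbleSum` — road «BF-x» for binder row D1, «A3.c ∕ L-X TAILS» PART II (I3c): the GRADED TWO-LEG TABLE through two leg
# pieces under the moment weight — punctured partial sums converge, `|fullSum| ≤ A` with `A` fixed before the scale (Part II's tail module headline)

HONEST DEPENDENCY (page 1, mandatory): continuum YM on T⁴ ⇐ BetaPertH ∧ nine spine estimates (0/9 proved); BetaPertH ⇐ (D1) ∧ (D4) ∧
CAP+tail; G-an2-4 gates asym, D1 and NE2/3/4.  HONEST FRAMING (cell contract, verbatim): «discharging `BetaPertH` makes Bałaban's UV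
stability UNCONDITIONAL — a real constructive-QFT result; it is NOT the continuum limit and NOT the Clay problem.»  THIS MODULE DISCHARGES
NOTHING of the wall: [folklore] composition BY NAME of part (I3b) `TwoPointBubbles.exists_bound_moment_term₂` over the finite term list of part (F3b)
`GradedBiBubbleMoving.exists_eterms₂_of_graded_mov` (`WindowIdentification.fullSum_add`).  The rows of `K^∞` and of `g` are HYPOTHESES in the END's
shape; no `def`, no `Prop` minted, nothing cited anew, 0 sorry.  0 wall binders; NOT an A3.c row, NOT (K), NOT D1, NOT `BetaPertH`, NOT continuum,
NOT Clay.

ABSOLUTE RULE (cell charter, verbatim): «No internally-minted statement may enter as a cited fact. Every hypothesis is either kernel-proved in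
this package or a verbatim quotation of a PUBLISHED theorem with page reference. The manuscript(s) under audit are NOT citable for their own
disputed steps — they are the thing under adjudication; programme-internal (2001/route/tribunal) claims are never citable.»

WHY (owner d1-p2-g9 K-LOCAL-ROWS v0.3, the 8 A3.c rows; this lineage's N-d1leaf03g12-2): the road's A3.c words at `τ = (0,0,r,r')`, `(r,r') ≠ (0,0)`,
are `2N²·w_μw_ν·baseKer (biBubbleTable (legPiece r) (legPiece r') SbT SbT μ ν) b w`; with `biBubble_realK_realK` the table is `bub₂ (legPiece r) (legPiece r')
(b + w) b V W` for the located, graded sector stencils `V`, `W` (each of grading `≥ 1`).  This file bounds its weighted full sum uniformly in the scale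
and in `b`; part (J) instantiates the rows from the printed `h12`∕`h126` and assembles the 8 `hLoc` clauses.
* [folklore] `exists_bound_moment_terms₂` (finite lists), **`exists_bound_fullSum_moment_bub₂`**: `Graded n₁ V → Graded n₂ W → 1 ≤ n₁ → 2 ≤ n₁ + n₂ →
  (r, r') ≠ (0, 0) → ∃ A ≥ 0, ∀ n ≥ 1, ∀ g even obeying the rows with `K^∞`, ∀ b μ ν`, convergence of the punctured partial sums and `|fullSum| ≤ A`.
Unit `b2b-balaban-beta-d1-formalise-leaf-03` (gen 12), D1 formalisation swarm; `LEAVES-BFx.md` row «A3.c ∕ L-X TAILS» PART II (I3c).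
-/

noncomputable section

namespace Summit.QuantumFields.BalabanUV.Beta.D1BFx.TwoPointBubbleSum

open Filter Topology
open Literature.MathematicalPhysics.QuantumFieldTheory.Balaban1983to89.Beta
open DyadicShell (Pt supNorm toReal)
open BubbleTransfer (unitVec)
open GhostTable (gFree)
open VectorPropagatorLimit (Kinf)
open WindowIdentification (psum fullSum fullSum_add fullSum_eq_of_tendsto exists_tendsto_psum_of_summable)
open GradedBubbles (Stn Graded IsStep)
open BiBubbleTable (bub₂)
open GradedBiBubbleTerms (ETerm₂)
open GradedBiBubbleMoving (exists_eterms₂_of_graded_mov)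
open TwoPointBubbles (exists_bound_moment_term₂)
open Summit.QuantumFields.BalabanUV.Beta.D1BFx.FineHessianLegGrades (legPiece)

variable {a δ A₀ A₁ D₀ D₁ : ℝ}

/-- [folklore] **A FINITE LIST OF TWO-POINT TERMS** (each with unit steps, `2 ≤ len`, a moving step) through `legPiece r`, `legPiece r'`, `(r, r') ≠ (0, 0)`:
ONE bound, fixed before the scale, for the full sum of the weighted list sum (induction on the list, `fullSum_add`). -/
theorem exists_bound_moment_terms₂ (Lst : List (ETerm₂ (Fin 4)))
    (hL : ∀ t ∈ Lst, (∀ e ∈ t.sA ++ t.dA ++ t.dB ++ t.sB, IsStep e) ∧ 2 ≤ t.len ∧ 1 ≤ t.dA.length + t.dB.length)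
    (r r' : Fin 3) (hrr : ¬(r = 0 ∧ r' = 0)) (ha : 0 < a) (hδ : 0 < δ) (hA₀ : 0 ≤ A₀) (hA₁ : 0 ≤ A₁) (hD₀ : 0 ≤ D₀) (hD₁ : 0 ≤ D₁) :
    ∃ A : ℝ, 0 ≤ A ∧ ∀ (n : ℕ) [NeZero n], 1 ≤ n → ∀ (g : Pt → ℝ), (∀ w, g (-w) = g w) →
      (∀ (x w : Pt) (κ l : Fin 4), w ≠ 0 → |Kinf n a (x, κ) (x + w, l)| ≤ A₀ * Real.exp (-(δ / n) * supNorm w) / (supNorm w : ℝ) ^ 2) →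
      (∀ (x w : Pt) (κ l : Fin 4), w ≠ 0 → ∀ ρ : Fin 4,
        |Kinf n a (x, κ) (x + w + unitVec ρ, l) - Kinf n a (x, κ) (x + w, l)| ≤ A₁ * Real.exp (-(δ / n) * supNorm w) / (supNorm w : ℝ) ^ 3) →
      (∀ v : Pt, v ≠ 0 → |g v| ≤ A₀ * Real.exp (-(δ / n) * supNorm v) / (supNorm v : ℝ) ^ 2) →
      (∀ v : Pt, v ≠ 0 → ∀ ρ : Fin 4, |g (v + unitVec ρ) - g v| ≤ A₁ * Real.exp (-(δ / n) * supNorm v) / (supNorm v : ℝ) ^ 3) →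
      (∀ v : Pt, |g v - gFree v| ≤ D₀ / (n : ℝ) ^ 2) →
      (∀ (v : Pt) (ρ : Fin 4), |(g (v + unitVec ρ) - gFree (v + unitVec ρ)) - (g v - gFree v)| ≤ D₁ / (n : ℝ) ^ 3) →
      ∀ (b : Pt) (μ ν : Fin 4),
        Summable (fun w : Pt => (Lst.map fun t => toReal w μ * toReal w ν * t.eval (legPiece n a g r) (legPiece n a g r') (b + w) b).sum) ∧
        |fullSum (fun w : Pt => (Lst.map fun t => toReal w μ * toReal w ν * t.eval (legPiece n a g r) (legPiece n a g r') (b + w) b).sum)| ≤ A := by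
  induction Lst with
  | nil =>
      refine ⟨0, le_rfl, fun n _ hn g hg e0 e1 d0 d1 h0 h1 b μ ν => ?_⟩
      simp only [List.map_nil, List.sum_nil]
      refine ⟨summable_zero, ?_⟩
      have hz : fullSum (fun _ : Pt => (0 : ℝ)) = 0 := by
        refine fullSum_eq_of_tendsto ?_
        have : psum (fun _ : Pt => (0 : ℝ)) = fun _ => 0 := by funext R; simp [psum]
        rw [this]; exact tendsto_const_nhds
      rw [hz, abs_zero]
  | cons t Lst ih =>
      obtain ⟨A, hA, hrest⟩ := ih (fun t' ht' => hL t' (List.mem_cons_of_mem t ht'))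
      obtain ⟨B, hB, hterm⟩ := exists_bound_moment_term₂ t (hL t (by simp)).1 (hL t (by simp)).2.1 (hL t (by simp)).2.2 r r' hrr ha hδ hA₀ hA₁ hD₀ hD₁
      refine ⟨B + A, by positivity, fun n _ hn g hg e0 e1 d0 d1 h0 h1 b μ ν => ?_⟩
      obtain ⟨hs₁, hb₁⟩ := hterm n hn g hg e0 e1 d0 d1 h0 h1 b μ ν
      obtain ⟨hs₂, hb₂⟩ := hrest n hn g hg e0 e1 d0 d1 h0 h1 b μ ν
      simp only [List.map_cons, List.sum_cons]
      refine ⟨hs₁.add hs₂, ?_⟩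
      rw [fullSum_add (exists_tendsto_psum_of_summable _ hs₁) (exists_tendsto_psum_of_summable _ hs₂)]
      exact (abs_add_le _ _).trans (add_le_add hb₁ hb₂)

/-- [folklore] **PART II's TAIL-MODULE HEADLINE.**  For graded stencils `Graded n₁ V`, `Graded n₂ W` with `1 ≤ n₁`, `2 ≤ n₁ + n₂`, pieces `(r, r') ≠ (0, 0)`,
and row constants `a > 0`, `δ > 0`, `A₀, A₁, D₀, D₁ ≥ 0`: ONE `A ≥ 0` such that for every scale `n ≥ 1`, every even profile `g` and `K^∞` obeying at scale
`n` the entry rows d0∕d1 and the profile rows d0∕d1∕h0∕h1, every base point `b` and every `μ, ν`, the punctured partial sums of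
`w ↦ w_μw_ν·bub₂ (legPiece r) (legPiece r') (b + w) b V W` converge and `|fullSum| ≤ A` (uniformly in `n` and `b`). -/
theorem exists_bound_fullSum_moment_bub₂ {n₁ n₂ : ℕ} {V W : Stn (Fin 4)} (hV : Graded n₁ V) (hW : Graded n₂ W) (hn₁ : 1 ≤ n₁) (hn₂ : 2 ≤ n₁ + n₂)
    (r r' : Fin 3) (hrr : ¬(r = 0 ∧ r' = 0)) (ha : 0 < a) (hδ : 0 < δ) (hA₀ : 0 ≤ A₀) (hA₁ : 0 ≤ A₁) (hD₀ : 0 ≤ D₀) (hD₁ : 0 ≤ D₁) :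
    ∃ A : ℝ, 0 ≤ A ∧ ∀ (n : ℕ) [NeZero n], 1 ≤ n → ∀ (g : Pt → ℝ), (∀ w, g (-w) = g w) →
      (∀ (x w : Pt) (κ l : Fin 4), w ≠ 0 → |Kinf n a (x, κ) (x + w, l)| ≤ A₀ * Real.exp (-(δ / n) * supNorm w) / (supNorm w : ℝ) ^ 2) →
      (∀ (x w : Pt) (κ l : Fin 4), w ≠ 0 → ∀ ρ : Fin 4,
        |Kinf n a (x, κ) (x + w + unitVec ρ, l) - Kinf n a (x, κ) (x + w, l)| ≤ A₁ * Real.exp (-(δ / n) * supNorm w) / (supNorm w : ℝ) ^ 3) →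
      (∀ v : Pt, v ≠ 0 → |g v| ≤ A₀ * Real.exp (-(δ / n) * supNorm v) / (supNorm v : ℝ) ^ 2) →
      (∀ v : Pt, v ≠ 0 → ∀ ρ : Fin 4, |g (v + unitVec ρ) - g v| ≤ A₁ * Real.exp (-(δ / n) * supNorm v) / (supNorm v : ℝ) ^ 3) →
      (∀ v : Pt, |g v - gFree v| ≤ D₀ / (n : ℝ) ^ 2) →
      (∀ (v : Pt) (ρ : Fin 4), |(g (v + unitVec ρ) - gFree (v + unitVec ρ)) - (g v - gFree v)| ≤ D₁ / (n : ℝ) ^ 3) →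
      ∀ (b : Pt) (μ ν : Fin 4),
        (∃ B : ℝ, Tendsto (psum (fun w : Pt => toReal w μ * toReal w ν * bub₂ (legPiece n a g r) (legPiece n a g r') (b + w) b V W)) atTop (𝓝 B)) ∧
        |fullSum (fun w : Pt => toReal w μ * toReal w ν * bub₂ (legPiece n a g r) (legPiece n a g r') (b + w) b V W)| ≤ A := by
  obtain ⟨Lst, hL, hid⟩ := exists_eterms₂_of_graded_mov hV hW
  have hL' : ∀ t ∈ Lst, (∀ e ∈ t.sA ++ t.dA ++ t.dB ++ t.sB, IsStep e) ∧ 2 ≤ t.len ∧ 1 ≤ t.dA.length + t.dB.length := fun t ht =>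
    ⟨(hL t ht).1, le_trans hn₂ (hL t ht).2.1, le_trans hn₁ (hL t ht).2.2⟩
  obtain ⟨A, hA, h⟩ := exists_bound_moment_terms₂ Lst hL' r r' hrr ha hδ hA₀ hA₁ hD₀ hD₁
  refine ⟨A, hA, fun n _ hn g hg e0 e1 d0 d1 h0 h1 b μ ν => ?_⟩
  have e : (fun w : Pt => toReal w μ * toReal w ν * bub₂ (legPiece n a g r) (legPiece n a g r') (b + w) b V W) =
      fun w : Pt => (Lst.map fun t => toReal w μ * toReal w ν * t.eval (legPiece n a g r) (legPiece n a g r') (b + w) b).sum := by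
    funext w
    rw [hid (legPiece n a g r) (legPiece n a g r') (b + w) b, ← List.sum_map_mul_left]
  obtain ⟨hs, hb⟩ := h n hn g hg e0 e1 d0 d1 h0 h1 b μ ν
  rw [e]
  exact ⟨exists_tendsto_psum_of_summable _ hs, hb⟩

end Summit.QuantumFields.BalabanUV.Beta.D1BFx.TwoPointBubbleSum

end
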